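import Summits.ValiantsHypothesis.ValiantsHypothesis.Theorems.KPlusLogSqLawTropicalBFerrersRank

/-!
# Route «KPlusLogSqLaw», crux `TropicalB` (stmt-ValiantsHypothesis-19771) — the INDICATOR-RANK LAW: the counting exponent of a class structure is the
# rank of its exponent matrix over 0/1 matrices modulo separable matrices (Ferrers shape is irrelevant for counting)

HONEST FRAMING.  Proof file (pure theorems), seat val-sym-trop-p1 g17 (cell `pub-symmetroid`, 2026-08-28), `--supports stmt-ValiantsHypothesis-19771
--as helper`, toward the registered stubs `stub_tropThin` / `stub_tropFat` of `Cruxes/TropicalB/Lines/birth.lean` (crux `TropicalB`).  A slope-COUNTING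
law; nothing here is beyond counting or in-window; nothing bears on `WeakLifting`, DoorA26 / DoorA34, `MatrixDescartes` (stmt-ValiantsHypothesis-18050)
or VP ≠ VNP.

THE LAW.  Let `(d, v, ε)` be a design of format `(m, K)` and suppose that on the support the exponent matrix is, modulo SEPARABLE matrices, an
integer combination of `r` ARBITRARY `0/1` matrices: `ε a b l ≠ 0 → d l = u a + w b + Σ_j c j · [X j a b]` with `X : Fin r → Fin m → Fin m → Prop`
(decidable), `c : Fin r → ℤ`.  Then the slope of a present term `(σ, λ)` is `Σ u + Σ w + Σ_j c j · #{b : X j (σ b) b}` (`slope_eq_of_indicators`),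
each count lies in `[0, m]`, dominant terms have pairwise distinct slopes, hence

* `designRowD_of_indicators` — every unsigned dominant chain has `n + 1 ≤ (m+1)^r`;
* `card_dominant_le_of_indicators` — at most `(m+1)^r` terms are dominant at some integer slope.

The tree's FERRERS-RANK LAW (`designRowD_of_ferrers`, val-sym-trop-p1 g15: `X j a b := f j a < g j b` biorders) and TYPE-PATTERN law (g11: indicators of
type blocks) are the special cases with structured indicators (the former is `designRowD_of_indicators` with `X j a b := f j a < g j b`); the point of stating the
general form is the READING: for COUNTING only the rank matters, so every law BEYOND counting (the cell's target `BoundaryVertexLaw 2 2`, the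
`K = 4` fork) must use the SHAPE of the indicators — e.g. this seat's `TwoPort.designRowD_halfSwap` (`…TwoBoundaryPortExact`) is the rank-2 instance
`1_{TF} − 1_{FT}` separable for the port's boundary pair, while for a generic boundary pair the three indicators `1_{B₁}, 1_{B₂}, 1_{B₁ ∩ B₂}` have
rank 3 modulo separables and counting stops at `(m+1)³`.
-/

set_option linter.dupNamespace false
set_option autoImplicit false

namespace Summit.ValiantsHypothesis.ValiantsHypothesis.Theorems.KPlusLogSqLaw

namespace IndicatorRank

open Summit.ValiantsHypothesis.ValiantsHypothesis.Theorems.MatrixDescartes.Negative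
open Summit.ValiantsHypothesis.ValiantsHypothesis.Theorems.LacunarySymmetroidMatrixDescartes
open Finset

variable {m K r : ℕ}

/-- **slope through an indicator representation**: for a present term, `slope = Σ u + Σ w + Σ_j c j · #{b : X j (σ b) b}`. [folklore] -/
theorem slope_eq_of_indicators (d : Fin K → ℕ) (ε : Fin m → Fin m → Fin K → ℤ) (X : Fin r → Fin m → Fin m → Prop)
    [∀ j a b, Decidable (X j a b)] (c : Fin r → ℤ) (u w : Fin m → ℤ)
    (hrep : ∀ a b l, ε a b l ≠ 0 → (d l : ℤ) = u a + w b + ∑ j, c j * (if X j a b then 1 else 0))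
    {p : Equiv.Perm (Fin m) × (Fin m → Fin K)} (hp : termSign ε p ≠ 0) :
    TropicalCensus.slope d p = ∑ a, u a + ∑ b, w b + ∑ j, c j * ((univ.filter fun b : Fin m => X j (p.1 b) b).card : ℤ) := by
  have hpres := (termSign_ne_zero_iff ε p).1 hp
  unfold TropicalCensus.slope
  calc ∑ b, (d (p.2 b) : ℤ) = ∑ b, (u (p.1 b) + w b + ∑ j, c j * (if X j (p.1 b) b then 1 else 0)) :=
        sum_congr rfl fun b _ => hrep _ _ _ (hpres b)
    _ = ∑ b, u (p.1 b) + ∑ b, w b + ∑ b, ∑ j, c j * (if X j (p.1 b) b then 1 else 0) := by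
        rw [sum_add_distrib, sum_add_distrib]
    _ = ∑ a, u a + ∑ b, w b + ∑ j, c j * ((univ.filter fun b : Fin m => X j (p.1 b) b).card : ℤ) := by
        congr 1
        · congr 1
          exact Equiv.sum_comp p.1 u
        · rw [sum_comm]
          refine sum_congr rfl fun j _ => ?_
          rw [← mul_sum, Finset.natCast_card_filter]

/-- **THE INDICATOR-RANK LAW (chain form).**  Under an indicator representation of rank `r` of the exponents on the support (ARBITRARY `0/1`
matrices, modulo separable matrices), every unsigned dominant chain has `n + 1 ≤ (m+1)^r`. [folklore: slope counting] -/
theorem designRowD_of_indicators (d : Fin K → ℕ) (v ε : Fin m → Fin m → Fin K → ℤ) (X : Fin r → Fin m → Fin m → Prop)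
    [∀ j a b, Decidable (X j a b)] (c : Fin r → ℤ) (u w : Fin m → ℤ)
    (hrep : ∀ a b l, ε a b l ≠ 0 → (d l : ℤ) = u a + w b + ∑ j, c j * (if X j a b then 1 else 0)) :
    DesignRowD d v ε ((m + 1) ^ r - 1) := by
  classical
  intro n θ p hθ hdom hne
  let N : Fin (n + 1) → Fin r → Fin (m + 1) := fun k j =>
    ⟨(univ.filter fun b : Fin m => X j ((p k).1 b) b).card,
      Nat.lt_succ_of_le ((card_filter_le _ _).trans (by rw [card_univ, Fintype.card_fin]))⟩
  have hslope : ∀ k, TropicalCensus.slope d (p k) = ∑ a, u a + ∑ b, w b + ∑ j, c j * ((N k j : ℕ) : ℤ) := fun k =>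
    slope_eq_of_indicators d ε X c u w hrep (hdom k).1
  have hsm := slope_strictMono_of_chainD d v ε θ p hθ hdom hne
  have hinj : Function.Injective N := by
    intro k k' hkk'
    apply hsm.injective
    show TropicalCensus.slope d (p k) = TropicalCensus.slope d (p k')
    rw [hslope k, hslope k', hkk']
  have hcard := Fintype.card_le_of_injective N hinj
  rw [Fintype.card_fin, Fintype.card_fun, Fintype.card_fin, Fintype.card_fin] at hcard
  have hpos : 1 ≤ (m + 1) ^ r := Nat.one_le_pow _ _ (Nat.succ_pos m)
  omega

open scoped Classical in
/-- **THE INDICATOR-RANK LAW (vertex count).**  Under an indicator representation of rank `r`, at most `(m+1)^r` terms of the design are dominant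
at some integer slope. [folklore] -/
theorem card_dominant_le_of_indicators (d : Fin K → ℕ) (v ε : Fin m → Fin m → Fin K → ℤ) (X : Fin r → Fin m → Fin m → Prop)
    [∀ j a b, Decidable (X j a b)] (c : Fin r → ℤ) (u w : Fin m → ℤ)
    (hrep : ∀ a b l, ε a b l ≠ 0 → (d l : ℤ) = u a + w b + ∑ j, c j * (if X j a b then 1 else 0)) :
    (univ.filter fun q : Equiv.Perm (Fin m) × (Fin m → Fin K) => ∃ t : ℤ, IsDominant d v ε t q).card ≤ (m + 1) ^ r := by
  have h := card_dominant_le_succ d v ε (designRowD_of_indicators d v ε X c u w hrep)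
  have hpos : 1 ≤ (m + 1) ^ r := Nat.one_le_pow _ _ (Nat.succ_pos m)
  omega

open scoped Classical in
/-- **instance: ONE arbitrary 0/1 pattern.**  If every present incidence has exponent `e₀ + e₁·[X a b]` for a single (arbitrary, not necessarily
Ferrers) `0/1` matrix `X`, at most `m + 1` terms are dominant. [folklore] -/
theorem card_dominant_le_of_one_indicator (d : Fin K → ℕ) (v ε : Fin m → Fin m → Fin K → ℤ) (X : Fin m → Fin m → Prop)
    [∀ a b, Decidable (X a b)] (e₀ e₁ : ℕ) (hrep : ∀ a b l, ε a b l ≠ 0 → d l = if X a b then e₀ + e₁ else e₀) :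
    (Finset.univ.filter fun q : Equiv.Perm (Fin m) × (Fin m → Fin K) =>
      ∃ t : ℤ, IsDominant d v ε t q).card ≤ m + 1 := by
  have h := card_dominant_le_of_indicators d v ε (r := 1) (fun _ a b => X a b) (fun _ => (e₁ : ℤ)) (fun _ => (e₀ : ℤ)) (fun _ => 0) ?_
  · simpa using h
  · intro a b l hl
    rw [hrep a b l hl]
    simp only [Fin.sum_univ_one, add_zero]
    split_ifs <;> push_cast <;> ring

end IndicatorRank

end Summit.ValiantsHypothesis.ValiantsHypothesis.Theorems.KPlusLogSqLaw
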